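import Summits.CriticalPhenomena.PercolationContinuityZ3.Theorems.PercNearOneGluingNoHeavyQuantFarTreeBlockComb
import Summits.CriticalPhenomena.PercolationContinuityZ3.Theorems.PercNearOneGluingNoHeavyQuantFarTreeHubBlocks
import Summits.CriticalPhenomena.PercolationContinuityZ3.Theorems.PercNearOneGluingNoHeavyQuantFarTreeRow
import HarnessLib

/-!
# QUANT lane R8, FAR on trees: block-combs with equal private gates in the ROUTE VOCABULARY (tree-supported weights on the pairs of
# `Fin n`) — a generic gate-to-graph transfer and the essential (sure-gate-free) form of `Quant.farTree_blockComb_equalGates`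

builds on p205010 (kernel theorem, internal audit signed; external expert review pending)

Support file (`--supports stmt-CriticalPhenomena-4575`), QUANT lane typer seat prim-quant-stmt (gen 14), rung R8 of
`run/shared/lean/prim/quant/LADDER.md`; completes the lead g10 ask (2)(i) in the vocabulary of the R8 target `Quant.FarRelayRow` (pattern of
p1 g6's `Quant.farRelayRow_tree_comb` and p1 g7's `Quant.farRelayRow_tree_blockComb_cell`).  Theorems only; no definitions, no sorries, standard axioms.

In the `par`/`depth` coordinates of `Quant.tree_cluster_transfer` (weights `w` on `Sym2 (Fin n)` supported on a rooted spanning tree, weight `0`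
prunes) a glued block is a PATH of weight-one edges, so the ancestor sets `Anc b = {par^[i] b | i ≤ depth b}` of its relays are nested rather than
equal; the fibres of `Quant.blockComb_count_eq` are recovered from the ESSENTIAL ancestor sets `{y ∈ Anc b | w s(par y, y) ≠ 1}` (sure gates erased —
they are open almost surely).

* `Quant.light_real_eq_essential` — erasing the sure gates (`q y = 1`) from every ancestor set does not change the probability of the light
  event (`Quant.prodBernoulli_real_eq_union_of_gate_one`);  `Quant.essential_axioms` — the forest axioms survive;  `Quant.prod_filter_ne_one_eq`.
* `Quant.farTree_blockComb_equalGates_essential` — `Quant.farTree_blockComb_equalGates` with the block-comb and equal-gate hypotheses read on the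
  ESSENTIAL ancestor sets (glued classes as weight-one paths allowed).
* `Quant.farRelayRow_tree_of_gate` — **generic transfer** (`o ∉ A`): to bound `P(#{b ∈ A | o ↔ b} ≤ j)` for tree-supported `w` it suffices to
  bound the gate-coordinate light event for the ancestor finsets `P` and gates `q` of `Quant.tree_ancestor_axioms`, knowing the forest axioms and
  the marginal identities `∏_{P b} q = P(o ↔ b)` (packaged from `Quant.farRelayRow_tree_of_farTreeRow`'s proof, for use by every cell theorem).
* `Quant.farRelayRow_tree_blockComb_equalGates` — **the body of `Quant.FarRelayRow` at EVERY layer** for tree-supported weights whose relays form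
  a block-comb with equal private gates around a least likely relay `a` (essential ancestor sets of distinct fibres meet only on `a`'s, one
  private-gate value `g`), `o ∉ A`.
[this work]; [cite: KozmaNitzan2024, Conjecture 3 (p. 15)] (the gluing rows served); conditioning on sure edges [cite: Grimmett1999, §2.4].
-/

noncomputable section

namespace Summit.CriticalPhenomena.PercolationContinuityZ3.Theorems

namespace Quant

open Finset MeasureTheory
open Literature.Probability.LatticeModels
open Literature.Probability.Percolation
open scoped Classical

/-! ### Erasing sure gates -/

section Essential

variable {m : ℕ}

/-- **Sure gates may be erased from the ancestor sets.**  For gates `q` on `Fin m`, ancestor finsets `P`, relays `A` and a layer `j`: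
`P(#{b ∈ A : P b open} ≤ j) = P(#{b ∈ A : {y ∈ P b | q y ≠ 1} open} ≤ j)`. [folklore] -/
theorem light_real_eq_essential (q : Fin m → unitInterval) (P : Fin m → Finset (Fin m)) (A : Finset (Fin m)) (j : ℕ) :
    (prodBernoulli q).real {ω : Set (Fin m) | (A.filter fun b => ((P b : Finset (Fin m)) : Set (Fin m)) ⊆ ω).card ≤ j} =
      (prodBernoulli q).real {ω : Set (Fin m) |
        (A.filter fun b => (((P b).filter fun y => q y ≠ 1 : Finset (Fin m)) : Set (Fin m)) ⊆ ω).card ≤ j} := by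
  set T : Finset (Fin m) := Finset.univ.filter fun y => q y = 1 with hT
  have hT1 : ∀ y ∈ T, q y = 1 := fun y hy => (Finset.mem_filter.1 hy).2
  rw [prodBernoulli_real_eq_union_of_gate_one q T hT1]
  congr 1
  ext ω
  simp only [Set.mem_setOf_eq]
  suffices h : ∀ b, (((P b : Finset (Fin m)) : Set (Fin m)) ⊆ ω ∪ ↑T ↔
      (((P b).filter fun y => q y ≠ 1 : Finset (Fin m)) : Set (Fin m)) ⊆ ω) by
    rw [Finset.filter_congr fun b _ => h b]
  intro b
  constructor
  · intro h y hy
    obtain ⟨hyP, hq⟩ := Finset.mem_filter.1 (Finset.mem_coe.1 hy)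
    rcases h (Finset.mem_coe.2 hyP) with hω | hT'
    · exact hω
    · exact absurd (hT1 y hT') hq
  · intro h y hy
    by_cases hq : q y = 1
    · exact Or.inr (Finset.mem_coe.2 (Finset.mem_filter.2 ⟨Finset.mem_univ _, hq⟩))
    · exact Or.inl (h (Finset.mem_coe.2 (Finset.mem_filter.2 ⟨Finset.mem_coe.1 hy, hq⟩)))

/-- The forest axioms (`y ∈ P x → P y ⊆ P x`; members of `P x` pairwise comparable) survive the erasure of the sure gates. [folklore] -/
theorem essential_axioms (q : Fin m → unitInterval) (P : Fin m → Finset (Fin m))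
    (h2 : ∀ x, ∀ y ∈ P x, P y ⊆ P x) (h3 : ∀ x, ∀ y ∈ P x, ∀ z ∈ P x, y ∈ P z ∨ z ∈ P y) :
    (∀ x, ∀ y ∈ (P x).filter (fun y => q y ≠ 1), (P y).filter (fun y => q y ≠ 1) ⊆ (P x).filter (fun y => q y ≠ 1)) ∧
    (∀ x, ∀ y ∈ (P x).filter (fun y => q y ≠ 1), ∀ z ∈ (P x).filter (fun y => q y ≠ 1),
      y ∈ (P z).filter (fun y => q y ≠ 1) ∨ z ∈ (P y).filter (fun y => q y ≠ 1)) := by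
  refine ⟨fun x y hy => ?_, fun x y hy z hz => ?_⟩
  · obtain ⟨hyP, _⟩ := Finset.mem_filter.1 hy
    intro z hz
    obtain ⟨hzP, hzq⟩ := Finset.mem_filter.1 hz
    exact Finset.mem_filter.2 ⟨h2 x y hyP hzP, hzq⟩
  · obtain ⟨hyP, hyq⟩ := Finset.mem_filter.1 hy
    obtain ⟨hzP, hzq⟩ := Finset.mem_filter.1 hz
    rcases h3 x y hyP z hzP with h | h
    · exact Or.inl (Finset.mem_filter.2 ⟨h, hyq⟩)
    · exact Or.inr (Finset.mem_filter.2 ⟨h, hzq⟩)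

/-- Erasing sure gates does not change a marginal: `∏_{y ∈ S, q y ≠ 1} q y = ∏_{y ∈ S} q y`. [folklore] -/
theorem prod_filter_ne_one_eq (q : Fin m → unitInterval) (S : Finset (Fin m)) :
    ∏ y ∈ S.filter (fun y => q y ≠ 1), (q y : ℝ) = ∏ y ∈ S, (q y : ℝ) :=
  Finset.prod_filter_of_ne fun y _ hq h => hq (by rw [h, Set.Icc.coe_one])

/-- **FAR at every layer for block-combs with equal private gates — ESSENTIAL form.**  As `Quant.farTree_blockComb_equalGates`, with the
block-comb condition (distinct fibres meet only on the chain) and the equal-private-gate condition read on the ESSENTIAL ancestor sets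
`{y ∈ P x | q y ≠ 1}`; so glued classes may be paths of weight-one gates (the shape delivered by `Quant.tree_ancestor_axioms`). [this work] -/
theorem farTree_blockComb_equalGates_essential (P : Fin m → Finset (Fin m))
    (h2 : ∀ x, ∀ y ∈ P x, P y ⊆ P x) (h3 : ∀ x, ∀ y ∈ P x, ∀ z ∈ P x, y ∈ P z ∨ z ∈ P y)
    (q : Fin m → unitInterval) (A : Finset (Fin m)) (j : ℕ) (t : ℝ) (a : Fin m) (ha : a ∈ A)
    (hmin : ∀ b ∈ A, ∏ y ∈ P a, (q y : ℝ) ≤ ∏ y ∈ P b, (q y : ℝ))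
    (hcomb : ∀ b ∈ A, ∀ b' ∈ A, (P b).filter (fun y => q y ≠ 1) ≠ (P b').filter (fun y => q y ≠ 1) →
      (P b).filter (fun y => q y ≠ 1) ∩ (P b').filter (fun y => q y ≠ 1) ⊆ (P a).filter (fun y => q y ≠ 1))
    (g : ℝ) (hgate : ∀ b ∈ A, (P b).filter (fun y => q y ≠ 1) ≠ (P a).filter (fun y => q y ≠ 1) →
      ∏ y ∈ (P b).filter (fun y => q y ≠ 1) \ (P a).filter (fun y => q y ≠ 1), (q y : ℝ) = g)
    (hEN : (2 * j : ℝ) < ∑ b ∈ A, ∏ y ∈ P b, (q y : ℝ))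
    (ht : 1 - ∏ y ∈ P a, (q y : ℝ) ≤ t) :
    (prodBernoulli q).real {ω : Set (Fin m) | (A.filter fun b => ((P b : Finset (Fin m)) : Set (Fin m)) ⊆ ω).card ≤ j} ≤ t := by
  rw [light_real_eq_essential q P A j]
  obtain ⟨h2', h3'⟩ := essential_axioms q P h2 h3
  have hprod : ∀ b, ∏ y ∈ (P b).filter (fun y => q y ≠ 1), (q y : ℝ) = ∏ y ∈ P b, (q y : ℝ) :=
    fun b => prod_filter_ne_one_eq q (P b)
  refine farTree_blockComb_equalGates (fun x => (P x).filter fun y => q y ≠ 1) h2' h3' q A j t a ha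
    (fun b hb => by rw [hprod, hprod]; exact hmin b hb) hcomb g hgate ?_ (by rw [hprod]; exact ht)
  rw [Finset.sum_congr rfl fun b _ => hprod b]; exact hEN

end Essential

/-! ### The generic gate-to-graph transfer -/

section Transfer

variable {n : ℕ}

/-- **Generic transfer, `o ∉ A`.**  For weights on the pairs of `Fin n` supported on a rooted spanning tree (`par`/`depth` coordinates), the
far-relay conclusion `P(#{b ∈ A | o ↔ b} ≤ j) ≤ t` follows from the same bound for the gate-coordinate light event of the ancestor finsets
`P x = {par^[i] x | i ≤ depth x}` (`P o = {o}`) under the gates `q x = w s(par x, x)` (`q o = 1`) — which the caller proves knowing the forest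
axioms (`Quant.tree_ancestor_axioms`) and the marginal identities `∏_{P b} q = P(o ↔ b)` (`b ≠ o`).  [this work] -/
theorem farRelayRow_tree_of_gate (n : ℕ) (w : Sym2 (Fin n) → unitInterval) (o : Fin n)
    (depth : Fin n → ℕ) (par : Fin n → Fin n)
    (hroot : ∀ x, x ≠ o → depth x = 0 → par x = o)
    (hstep : ∀ x, x ≠ o → depth x ≠ 0 → par x ≠ o ∧ depth (par x) + 1 = depth x)
    (hsupp : ∀ e, w e ≠ 0 → e.IsDiag ∨ ∃ x, x ≠ o ∧ e = s(par x, x))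
    (A : Finset (Fin n)) (hoA : o ∉ A) (j : ℕ) (t : ℝ)
    (h : ∀ (q : Fin n → unitInterval) (P : Fin n → Finset (Fin n)),
      (∀ x, x ≠ o → q x = w s(par x, x)) → q o = 1 →
      (∀ x, x ≠ o → P x = (Finset.range (depth x + 1)).image (fun i => par^[i] x)) →
      (∀ x, x ∈ P x) → (∀ x, ∀ y ∈ P x, P y ⊆ P x) → (∀ x, ∀ y ∈ P x, ∀ z ∈ P x, y ∈ P z ∨ z ∈ P y) →
      (∀ b, b ≠ o → ∏ y ∈ P b, (q y : ℝ) = (prodBernoulli w).real (openConn o b)) →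
      (prodBernoulli q).real
          {ω : Set (Fin n) | (A.filter fun b => ((P b : Finset (Fin n)) : Set (Fin n)) ⊆ ω).card ≤ j} ≤ t) :
    (prodBernoulli w).real {ω : BondConfig (Fin n) | (A.filter fun b => ω ∈ openConn o b).card ≤ j} ≤ t := by
  rw [tree_relayCount_transfer n w o depth par hroot hstep hsupp A j]
  set q : Fin n → unitInterval := fun x => if x = o then 1 else w s(par x, x) with hq
  set P : Fin n → Finset (Fin n) :=
    fun x => if x = o then {o} else (Finset.range (depth x + 1)).image (fun i => par^[i] x) with hP
  obtain ⟨h1, h2, h3⟩ := tree_ancestor_axioms o depth par hstep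
  have hAo : ∀ b ∈ A, b ≠ o := fun b hb hbo => hoA (hbo ▸ hb)
  -- the event
  have hevent : ∀ b, b ≠ o → ∀ ω' : Set (Fin n),
      (b = o ∨ ∀ i, i ≤ depth b → par^[i] b ∈ ω') ↔ ((P b : Finset (Fin n)) : Set (Fin n)) ⊆ ω' := by
    intro b hbo ω'
    simp only [hbo, false_or, hP, if_neg hbo, Finset.coe_image, Finset.coe_range, Set.image_subset_iff]
    constructor
    · intro h i hi
      exact h i (by simpa [Nat.lt_succ_iff] using hi)
    · intro h i hi
      exact h (show i ∈ Set.Iio (depth b + 1) by simpa [Nat.lt_succ_iff] using hi)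
  have hset : {ω' : Set (Fin n) | (A.filter fun b => b = o ∨ ∀ i, i ≤ depth b → par^[i] b ∈ ω').card ≤ j} =
      {ω' : Set (Fin n) | (A.filter fun b => ((P b : Finset (Fin n)) : Set (Fin n)) ⊆ ω').card ≤ j} := by
    ext ω'
    simp only [Set.mem_setOf_eq]
    rw [Finset.filter_congr fun b hb => hevent b (hAo b hb) ω']
  rw [hset]
  -- the marginals
  have hmarg : ∀ b, b ≠ o → ∏ y ∈ P b, (q y : ℝ) = (prodBernoulli w).real (openConn o b) := by
    intro b hbo
    rw [tree_real_openConn_eq_prod n w o depth par hroot hstep hsupp b hbo]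
    have hPb : P b = (Finset.range (depth b + 1)).image (fun i => par^[i] b) := by simp only [hP, if_neg hbo]
    rw [hPb, Finset.prod_image (tree_iterate_injOn o depth par hstep b hbo)]
    refine Finset.prod_congr rfl fun i hi => ?_
    have hne := (tree_iterate_par o depth par hstep b hbo i (by have := Finset.mem_range.1 hi; omega)).1
    simp [hq, hne]
  exact h q P (fun x hx => by simp [hq, hx]) (by simp [hq]) (fun x hx => by simp only [hP, if_neg hx]) h1 h2 h3 hmarg

/-- Vertices on an ancestral line are not the root. [folklore] -/
theorem tree_mem_ancestors_ne_root (o : Fin n) (depth : Fin n → ℕ) (par : Fin n → Fin n)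
    (hstep : ∀ x, x ≠ o → depth x ≠ 0 → par x ≠ o ∧ depth (par x) + 1 = depth x)
    (b : Fin n) (hbo : b ≠ o) (y : Fin n) (hy : y ∈ (Finset.range (depth b + 1)).image (fun i => par^[i] b)) : y ≠ o := by
  obtain ⟨i, hi, rfl⟩ := Finset.mem_image.1 hy
  exact (tree_iterate_par o depth par hstep b hbo i (by have := Finset.mem_range.1 hi; omega)).1

/-- **FAR AT EVERY LAYER FOR BLOCK-COMBS WITH EQUAL PRIVATE GATES, route vocabulary (`o ∉ A`).**  Weights on the pairs of `Fin n` supported on a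
rooted spanning tree (`par`/`depth` coordinates; weight `0` prunes); ESSENTIAL ancestor sets `E b = {par^[i] b | i ≤ depth b, w s(par ·, ·) ≠ 1}`;
relays `A ∌ o` with a least likely relay `a`; BLOCK-COMB: `E b ≠ E b' → E b ∩ E b' ⊆ E a` on `A`; EQUAL PRIVATE GATES: one value `g` of
`∏_{y ∈ E b ∖ E a} w s(par y, y)` over `b ∈ A` with `E b ≠ E a`.  Then `2j < Σ_{b∈A} P(o ↔ b)` and `P(o ↮ b) ≤ t` on `A` give
`P(#{b ∈ A | o ↔ b} ≤ j) ≤ t` — the body of `Quant.FarRelayRow` on this family, every layer. [this work] -/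
theorem farRelayRow_tree_blockComb_equalGates (n : ℕ) (w : Sym2 (Fin n) → unitInterval) (o : Fin n)
    (depth : Fin n → ℕ) (par : Fin n → Fin n)
    (hroot : ∀ x, x ≠ o → depth x = 0 → par x = o)
    (hstep : ∀ x, x ≠ o → depth x ≠ 0 → par x ≠ o ∧ depth (par x) + 1 = depth x)
    (hsupp : ∀ e, w e ≠ 0 → e.IsDiag ∨ ∃ x, x ≠ o ∧ e = s(par x, x))
    (E : Fin n → Finset (Fin n))
    (hE : ∀ b, b ≠ o → E b = ((Finset.range (depth b + 1)).image (fun i => par^[i] b)).filter fun y => w s(par y, y) ≠ 1)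
    (A : Finset (Fin n)) (hoA : o ∉ A) (a : Fin n) (ha : a ∈ A)
    (hmin : ∀ b ∈ A, (prodBernoulli w).real (openConn o a) ≤ (prodBernoulli w).real (openConn o b))
    (hcomb : ∀ b ∈ A, ∀ b' ∈ A, E b ≠ E b' → E b ∩ E b' ⊆ E a)
    (g : ℝ) (hgate : ∀ b ∈ A, E b ≠ E a → ∏ y ∈ E b \ E a, (w s(par y, y) : ℝ) = g)
    (j : ℕ) (t : ℝ)
    (hEN : (2 * j : ℝ) < ∑ b ∈ A, (prodBernoulli w).real (openConn o b))
    (ht : ∀ b ∈ A, (prodBernoulli w).real (openConn o b : Set (BondConfig (Fin n)))ᶜ ≤ t) :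
    (prodBernoulli w).real {ω : BondConfig (Fin n) | (A.filter fun b => ω ∈ openConn o b).card ≤ j} ≤ t := by
  have hAo : ∀ b ∈ A, b ≠ o := fun b hb hbo => hoA (hbo ▸ hb)
  refine farRelayRow_tree_of_gate n w o depth par hroot hstep hsupp A hoA j t fun q P hq hqo hP h1 h2 h3 hmarg => ?_
  -- the essential ancestor sets of the relays are the `E b`
  have hPE : ∀ b ∈ A, (P b).filter (fun y => q y ≠ 1) = E b := by
    intro b hb
    have hbo := hAo b hb
    rw [hE b hbo, hP b hbo]
    refine Finset.filter_congr fun y hy => ?_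
    rw [hq y (tree_mem_ancestors_ne_root o depth par hstep b hbo y hy)]
  have hqE : ∀ b ∈ A, ∀ y ∈ E b, (q y : ℝ) = w s(par y, y) := by
    intro b hb y hy
    have hbo := hAo b hb
    rw [hE b hbo] at hy
    rw [hq y (tree_mem_ancestors_ne_root o depth par hstep b hbo y (Finset.mem_filter.1 hy).1)]
  refine farTree_blockComb_equalGates_essential P h2 h3 q A j t a ha ?_ ?_ g ?_ ?_ ?_
  · intro b hb; rw [hmarg a (hAo a ha), hmarg b (hAo b hb)]; exact hmin b hb
  · intro b hb b' hb'
    rw [hPE b hb, hPE b' hb', hPE a ha]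
    exact hcomb b hb b' hb'
  · intro b hb hne
    rw [hPE b hb, hPE a ha] at hne ⊢
    rw [← hgate b hb hne]
    exact Finset.prod_congr rfl fun y hy => hqE b hb y (Finset.mem_sdiff.1 hy).1
  · rw [Finset.sum_congr rfl fun b hb => hmarg b (hAo b hb)]; exact hEN
  · rw [hmarg a (hAo a ha), ← probReal_compl_eq_one_sub (Set.toFinite _).measurableSet]
    exact ht a ha

end Transfer

end Quant

end Summit.CriticalPhenomena.PercolationContinuityZ3.Theorems

end
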